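import Summits.Ventures.PercRepro.S2CubeMultiplicityLevel
import Summits.Ventures.PercRepro.RankLevelSetDepCountHeavyCap

/-!
# PercRepro — THE HEAVY / LIGHT COUNT WITH p4's CUBIC MULTIPLICITY AND THE SIZE-CAPPED HEAVY TERM (p8 g6, S3)

`proofs/SUBCLAIM-S3-p8.md` §3s. RankLevelSetMultFifteenCount with the fibre multiplicity
`cube ν = ν + 3·C(ν, 2) + 3·C(ν, 3)` (p4's `S2.card_pairs_ge_cube`, S2CubeMultiplicityLevel: a rank-`q` set of `q + ν`
elements reaches `≥ cube ν` pairs — `1, 5, 15, 34, 65, 111, …` against the `15`-multiplicity's `1, 5, 15, 22, 35, 51, …`):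
the level-`m` double count of the light sets (`mul_card_levelLight_le_sum_cube`, `mul_card_levelLight_le_cube`) and the
`U`-count `ncard_eRk_eq_ncard_le_le_heavy_cube_cap` with the fibre weights `1 / cube (j + 1)` —
`1, 1/5, 1/15, 1/34, 1/65, 1/111, …` — and the size-capped heavy term of RankLevelSetDepCountHeavyCap. The multiplicity is
written in closed form (`cube ν = ν(ν² + 1)/2`, `cube_choose_eq`), no new definition. Axioms: standard.
-/

open scoped Matroid

namespace PercRepro

namespace Matroid

open Set Finset

variable {α : Type} {M : _root_.Matroid α}

/-- **The cubic multiplicity in closed form**: `ν + 3·C(ν, 2) + 3·C(ν, 3) = ν(ν² + 1)/2` (`1, 5, 15, 34, 65, 111, …`). -/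
theorem cube_choose_eq (ν : ℕ) : ν + 3 * ν.choose 2 + 3 * ν.choose 3 = ν * (ν ^ 2 + 1) / 2 := by
  have h : 2 * (ν + 3 * ν.choose 2 + 3 * ν.choose 3) = ν * (ν ^ 2 + 1) := by
    induction ν with
    | zero => simp
    | succ n ih =>
      rw [Nat.choose_succ_succ, Nat.choose_succ_succ, Nat.choose_one_right]
      have h2 : 2 * n.choose 2 = n * (n - 1) := by
        rw [Nat.choose_two_right]
        exact Nat.mul_div_cancel' (Nat.even_mul_pred_self n).two_dvd
      rcases n with _ | n
      · simp
      · simp only [Nat.add_sub_cancel] at h2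
        nlinarith [ih, h2]
  omega

open scoped Classical in
/-- **The level-`m` double count of the LIGHT sets with the cubic multiplicity**:
`(m − q)(3(m − q) − 1)·#levelLight ≤ 2·Σ_{p ∈ pairsLight} #fibreLevel p m`. -/
theorem mul_card_levelLight_le_sum_cube [M.Finite] (q ν₁ : ℕ) (hq : 1 ≤ q) (hcirc : ∀ C, M.IsCircuit C → 3 ≤ C.encard)
    (hline : ∀ L ⊆ M.E, M.eRk L = 2 → L.ncard ≤ 3) (m : ℕ) :
    ((m - q) * ((m - q) ^ 2 + 1) / 2) * (levelLight M q ν₁ m).card ≤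
      ∑ p ∈ pairsLight M q ν₁, (fibreLevel M q p m).card := by
  have hstep1 : ∀ p : Set α × Set α, ((levelLight M q ν₁ m).filter (fun B : Finset α =>
      p.1 ∪ p.2 ⊆ (B : Set α) ∧ (B : Set α) ⊆ M.closure (p.1 ∪ p.2))).card ≤ (fibreLevel M q p m).card := by
    intro p
    unfold fibreLevel levelLight
    exact Finset.card_le_card (Finset.filter_subset_filter
      (fun B : Finset α => p.1 ∪ p.2 ⊆ (B : Set α) ∧ (B : Set α) ⊆ M.closure (p.1 ∪ p.2))
      (Finset.filter_subset (fun B : Finset α => (M.closure (B : Set α)).ncard + 1 ≤ q + ν₁) (levelF M q m)))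
  have hcomm : ∑ p ∈ pairsLight M q ν₁, ((levelLight M q ν₁ m).filter (fun B : Finset α =>
      p.1 ∪ p.2 ⊆ (B : Set α) ∧ (B : Set α) ⊆ M.closure (p.1 ∪ p.2))).card =
      ∑ B ∈ levelLight M q ν₁ m, ((pairsLight M q ν₁).filter (fun p : Set α × Set α =>
        p.1 ∪ p.2 ⊆ (B : Set α) ∧ (B : Set α) ⊆ M.closure (p.1 ∪ p.2))).card := by
    have e1 : ∀ p : Set α × Set α, ((levelLight M q ν₁ m).filter (fun B : Finset α =>
        p.1 ∪ p.2 ⊆ (B : Set α) ∧ (B : Set α) ⊆ M.closure (p.1 ∪ p.2))).card =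
        ∑ B ∈ levelLight M q ν₁ m,
          if p.1 ∪ p.2 ⊆ (B : Set α) ∧ (B : Set α) ⊆ M.closure (p.1 ∪ p.2) then 1 else 0 :=
      fun p => Finset.card_filter _ _
    have e2 : ∀ B : Finset α, ((pairsLight M q ν₁).filter (fun p : Set α × Set α =>
        p.1 ∪ p.2 ⊆ (B : Set α) ∧ (B : Set α) ⊆ M.closure (p.1 ∪ p.2))).card =
        ∑ p ∈ pairsLight M q ν₁,
          if p.1 ∪ p.2 ⊆ (B : Set α) ∧ (B : Set α) ⊆ M.closure (p.1 ∪ p.2) then 1 else 0 :=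
      fun B => Finset.card_filter _ _
    rw [Finset.sum_congr rfl (fun p _ => e1 p), Finset.sum_congr rfl (fun B _ => e2 B)]
    exact Finset.sum_comm
  have hB : ∀ B ∈ levelLight M q ν₁ m, ((m - q) * ((m - q) ^ 2 + 1) / 2) ≤ ((pairsLight M q ν₁).filter (fun p : Set α × Set α =>
      p.1 ∪ p.2 ⊆ (B : Set α) ∧ (B : Set α) ⊆ M.closure (p.1 ∪ p.2))).card := by
    intro B hB
    unfold levelLight at hB
    rw [Finset.mem_filter] at hB
    obtain ⟨hBl, hlight⟩ := hB
    obtain ⟨hBg, hBm, hBq⟩ := mem_levelF.1 hBl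
    have hBE : (B : Set α) ⊆ M.E := by rw [← coe_groundF]; exact_mod_cast hBg
    have hsub : ((Matroid.pairsF M q).filter (fun p => p.1 ∪ p.2 ⊆ (B : Set α) ∧
        (B : Set α) ⊆ M.closure (p.1 ∪ p.2))).card ≤ ((pairsLight M q ν₁).filter (fun p : Set α × Set α =>
        p.1 ∪ p.2 ⊆ (B : Set α) ∧ (B : Set α) ⊆ M.closure (p.1 ∪ p.2))).card := by
      apply Finset.card_le_card
      intro p hp
      rw [Finset.mem_filter] at hp ⊢
      refine ⟨?_, hp.2⟩
      unfold pairsLight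
      rw [Finset.mem_filter]
      refine ⟨hp.1, ?_⟩
      rw [closure_eq_of_reaches hp.2.1 hp.2.2]
      exact hlight
    have h := S2.card_pairs_ge_cube q hq hcirc hline hBE hBq
    rw [hBm, cube_choose_eq] at h
    exact h.trans hsub
  calc ((m - q) * ((m - q) ^ 2 + 1) / 2) * (levelLight M q ν₁ m).card
        = ∑ _B ∈ levelLight M q ν₁ m, ((m - q) * ((m - q) ^ 2 + 1) / 2) := by simp [mul_comm]
    _ ≤ ∑ B ∈ levelLight M q ν₁ m, ((pairsLight M q ν₁).filter (fun p : Set α × Set α =>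
        p.1 ∪ p.2 ⊆ (B : Set α) ∧ (B : Set α) ⊆ M.closure (p.1 ∪ p.2))).card := Finset.sum_le_sum hB
    _ = ∑ p ∈ pairsLight M q ν₁, ((levelLight M q ν₁ m).filter (fun B : Finset α =>
        p.1 ∪ p.2 ⊆ (B : Set α) ∧ (B : Set α) ⊆ M.closure (p.1 ∪ p.2))).card := by rw [hcomm]
    _ ≤ ∑ p ∈ pairsLight M q ν₁, (fibreLevel M q p m).card :=
        Finset.sum_le_sum (fun p _ => hstep1 p)

open scoped Classical in
/-- **The level-`m` count of the light sets with the cubic multiplicity.** -/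
theorem mul_card_levelLight_le_cube [M.Finite] (q f' ν₁ : ℕ) (hq : 1 ≤ q) (hcirc : ∀ C, M.IsCircuit C → 3 ≤ C.encard)
    (hline : ∀ L ⊆ M.E, M.eRk L = 2 → L.ncard ≤ 3) (m : ℕ) :
    ((m - q) * ((m - q) ^ 2 + 1) / 2) * (levelLight M q ν₁ m).card ≤
      ((pairsLight M q ν₁).filter (fun p => p ∈ pairsSmall M q f')).card *
          (min (f' - q) (ν₁ - 2)).choose (m - (q + 1)) +
        ((pairsLight M q ν₁).filter (fun p => p ∉ pairsSmall M q f')).card * (ν₁ - 2).choose (m - (q + 1)) := by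
  have hsplit : ∑ p ∈ pairsLight M q ν₁, (fibreLevel M q p m).card =
      ∑ p ∈ (pairsLight M q ν₁).filter (fun p => p ∈ pairsSmall M q f'), (fibreLevel M q p m).card +
        ∑ p ∈ (pairsLight M q ν₁).filter (fun p => p ∉ pairsSmall M q f'), (fibreLevel M q p m).card :=
    (Finset.sum_filter_add_sum_filter_not (pairsLight M q ν₁) _ _).symm
  calc ((m - q) * ((m - q) ^ 2 + 1) / 2) * (levelLight M q ν₁ m).card
        ≤ ∑ p ∈ pairsLight M q ν₁, (fibreLevel M q p m).card :=
        mul_card_levelLight_le_sum_cube q ν₁ hq hcirc hline m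
    _ = _ := by rw [hsplit]
    _ ≤ ∑ _p ∈ (pairsLight M q ν₁).filter (fun p => p ∈ pairsSmall M q f'),
          (min (f' - q) (ν₁ - 2)).choose (m - (q + 1)) +
          ∑ _p ∈ (pairsLight M q ν₁).filter (fun p => p ∉ pairsSmall M q f'), (ν₁ - 2).choose (m - (q + 1)) :=
        add_le_add
          (Finset.sum_le_sum (fun p hp => by
            rw [Finset.mem_filter] at hp
            exact card_fibreLevel_light_small q f' ν₁ hp.1 hp.2 m))
          (Finset.sum_le_sum (fun p hp => by
            rw [Finset.mem_filter] at hp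
            exact card_fibreLevel_light q ν₁ hp.1 m))
    _ = _ := by rw [Finset.sum_const, smul_eq_mul, Finset.sum_const, smul_eq_mul]

open scoped Classical in
/-- **The `U`-count with the heavy / light split, the CUBIC multiplicity and the SIZE-CAPPED heavy term**, in `ℚ`:
`#{B ⊆ E : r(B) = q, |B| ≤ d} ≤ C(n, q) + σ³(min(f′ − q, ν₁ − 2))·#(light small pairs) + σ³(ν₁ − 2)·#(light big pairs)
  + #{heavy sets of ≤ d elements}`, `σ(a) = Σ_{j ≤ d − q − 1} C(a, j)/cube(j + 1)`. -/
theorem ncard_eRk_eq_ncard_le_le_heavy_cube_cap (M : _root_.Matroid α) [M.Finite] (q f' ν₁ : ℕ) (hq : 1 ≤ q)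
    (hcirc : ∀ C, M.IsCircuit C → 3 ≤ C.encard) (hline : ∀ L ⊆ M.E, M.eRk L = 2 → L.ncard ≤ 3) (d : ℕ) :
    ({B : Set α | B ⊆ M.E ∧ M.eRk B = q ∧ B.ncard ≤ d}.ncard : ℚ) ≤
      (M.E.ncard.choose q : ℚ) +
        (∑ j ∈ Finset.range (d - (q + 1) + 1), ((min (f' - q) (ν₁ - 2)).choose j : ℚ) * (1 / ((((j + 1) * ((j + 1) ^ 2 + 1) / 2 : ℕ) : ℚ)))) *
          (((pairsLight M q ν₁).filter (fun p => p ∈ pairsSmall M q f')).card : ℚ) +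
        (∑ j ∈ Finset.range (d - (q + 1) + 1), ((ν₁ - 2).choose j : ℚ) * (1 / ((((j + 1) * ((j + 1) ^ 2 + 1) / 2 : ℕ) : ℚ)))) *
          (((pairsLight M q ν₁).filter (fun p => p ∉ pairsSmall M q f')).card : ℚ) +
        ({B : Set α | B ⊆ M.E ∧ M.eRk B = (q : ℕ∞) ∧ q + ν₁ ≤ (M.closure B).ncard ∧ B.ncard ≤ d}.ncard : ℚ) := by
  set Ef := groundF M with hEf
  have hE : (Ef : Set α) = M.E := coe_groundF M
  have hEcard : Ef.card = M.E.ncard := card_groundF M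
  set S := {B : Set α | B ⊆ M.E ∧ M.eRk B = q ∧ B.ncard ≤ d} with hS
  set S₁ := {B : Set α | B ⊆ (Ef : Set α) ∧ B.ncard = q} with hS₁
  set S₂ := {B : Set α | B ⊆ M.E ∧ M.eRk B = q ∧ q < B.ncard ∧ B.ncard ≤ d} with hS₂
  set Hv := {B : Set α | B ⊆ M.E ∧ M.eRk B = (q : ℕ∞) ∧ q + ν₁ ≤ (M.closure B).ncard ∧ B.ncard ≤ d} with hHv
  set Ps := ((pairsLight M q ν₁).filter (fun p => p ∈ pairsSmall M q f')).card with hPs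
  set Pb := ((pairsLight M q ν₁).filter (fun p => p ∉ pairsSmall M q f')).card with hPb
  have hsplit : S ⊆ S₁ ∪ S₂ := by
    intro B hB
    have hBfin : B.Finite := M.ground_finite.subset hB.1
    have hle : q ≤ B.ncard := by
      have := M.eRk_le_encard B
      rw [hB.2.1, ← hBfin.cast_ncard_eq] at this
      exact_mod_cast this
    rcases hle.lt_or_eq with h | h
    · exact Or.inr ⟨hB.1, hB.2.1, h, hB.2.2⟩
    · exact Or.inl ⟨by rw [hE]; exact hB.1, h.symm⟩
  have hS₁fin : S₁.Finite := (Ef.finite_toSet.finite_subsets).subset (fun B hB => hB.1)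
  have hS₂fin : S₂.Finite := M.ground_finite.finite_subsets.subset (fun B hB => hB.1)
  have hS₁ : S₁.ncard = M.E.ncard.choose q := by
    rw [hS₁, ncard_subsets_ncard_eq Ef q, hEcard]
  -- the light levels
  have hlevel : ∀ m ∈ Finset.Icc (q + 1) d, ((levelLight M q ν₁ m).card : ℚ) ≤
      ((Ps : ℚ) * ((min (f' - q) (ν₁ - 2)).choose (m - (q + 1)) : ℚ) +
        (Pb : ℚ) * ((ν₁ - 2).choose (m - (q + 1)) : ℚ)) *
        (1 / ((((m - q) * ((m - q) ^ 2 + 1) / 2 : ℕ) : ℚ))) := by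
    intro m hm
    rw [Finset.mem_Icc] at hm
    have hpos : (0 : ℚ) < ((((m - q) * ((m - q) ^ 2 + 1) / 2) : ℕ) : ℚ) := by
      have h1 : 1 ≤ m - q := by omega
      have h2 : 1 ≤ (m - q) * ((m - q) ^ 2 + 1) / 2 := by
        rw [← cube_choose_eq]; omega
      exact_mod_cast h2
    rw [mul_div_assoc', le_div_iff₀ hpos, mul_one, mul_comm]
    have h := mul_card_levelLight_le_cube q f' ν₁ hq hcirc hline m
    exact_mod_cast h
  -- the levels
  have hS₂q : (S₂.ncard : ℚ) ≤ ∑ m ∈ Finset.Icc (q + 1) d,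
      ((Ps : ℚ) * ((min (f' - q) (ν₁ - 2)).choose (m - (q + 1)) : ℚ) +
        (Pb : ℚ) * ((ν₁ - 2).choose (m - (q + 1)) : ℚ)) *
        (1 / ((((m - q) * ((m - q) ^ 2 + 1) / 2 : ℕ) : ℚ))) + (Hv.ncard : ℚ) := by
    have h3' : ∑ m ∈ Finset.Icc (q + 1) d, (levelHeavy M q ν₁ m).card ≤ Hv.ncard := by
      rw [hHv]
      exact sum_card_levelHeavy_le_cap q ν₁ d
    have h3q : ((∑ m ∈ Finset.Icc (q + 1) d, (levelHeavy M q ν₁ m).card : ℕ) : ℚ) ≤ (Hv.ncard : ℚ) := by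
      exact_mod_cast h3'
    have h2 : ∑ m ∈ Finset.Icc (q + 1) d, (levelF M q m).card =
        ∑ m ∈ Finset.Icc (q + 1) d, (levelLight M q ν₁ m).card +
          ∑ m ∈ Finset.Icc (q + 1) d, (levelHeavy M q ν₁ m).card := by
      rw [← Finset.sum_add_distrib]
      exact Finset.sum_congr rfl (fun m _ => card_levelF_eq_light_add_heavy q ν₁ m)
    calc (S₂.ncard : ℚ) ≤ ((∑ m ∈ Finset.Icc (q + 1) d, (levelF M q m).card : ℕ) : ℚ) := by
          exact_mod_cast ncard_dep_le_sum_levelF q d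
      _ = ∑ m ∈ Finset.Icc (q + 1) d, ((levelLight M q ν₁ m).card : ℚ) +
            ((∑ m ∈ Finset.Icc (q + 1) d, (levelHeavy M q ν₁ m).card : ℕ) : ℚ) := by
          rw [h2]
          push_cast
          rfl
      _ ≤ _ := add_le_add (Finset.sum_le_sum hlevel) h3q
  -- re-index the level sums
  have hre : ∑ m ∈ Finset.Icc (q + 1) d,
      ((Ps : ℚ) * ((min (f' - q) (ν₁ - 2)).choose (m - (q + 1)) : ℚ) +
        (Pb : ℚ) * ((ν₁ - 2).choose (m - (q + 1)) : ℚ)) *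
        (1 / ((((m - q) * ((m - q) ^ 2 + 1) / 2 : ℕ) : ℚ))) =
      ∑ j ∈ Finset.range (d - q),
        ((Ps : ℚ) * (((min (f' - q) (ν₁ - 2)).choose j : ℚ) * (1 / ((((j + 1) * ((j + 1) ^ 2 + 1) / 2 : ℕ) : ℚ)))) +
          (Pb : ℚ) * (((ν₁ - 2).choose j : ℚ) * (1 / ((((j + 1) * ((j + 1) ^ 2 + 1) / 2 : ℕ) : ℚ))))) := by
    rw [show Finset.Icc (q + 1) d = Finset.image (fun j => q + 1 + j) (Finset.range (d - q)) from ?_]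
    · rw [Finset.sum_image (fun a _ b _ h => by omega)]
      apply Finset.sum_congr rfl
      intro j _
      rw [show q + 1 + j - (q + 1) = j by omega, show q + 1 + j - q = j + 1 by omega]
      ring
    · ext m
      rw [Finset.mem_Icc, Finset.mem_image]
      constructor
      · intro hm
        exact ⟨m - (q + 1), by rw [Finset.mem_range]; omega, by omega⟩
      · rintro ⟨j, hj, rfl⟩
        rw [Finset.mem_range] at hj
        omega
  have hrange : Finset.range (d - q) ⊆ Finset.range (d - (q + 1) + 1) := Finset.range_mono (by omega)
  have hS₂q' : (S₂.ncard : ℚ) ≤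
      (∑ j ∈ Finset.range (d - (q + 1) + 1), ((min (f' - q) (ν₁ - 2)).choose j : ℚ) * (1 / ((((j + 1) * ((j + 1) ^ 2 + 1) / 2 : ℕ) : ℚ)))) * (Ps : ℚ) +
        (∑ j ∈ Finset.range (d - (q + 1) + 1), ((ν₁ - 2).choose j : ℚ) * (1 / ((((j + 1) * ((j + 1) ^ 2 + 1) / 2 : ℕ) : ℚ)))) * (Pb : ℚ) +
        (Hv.ncard : ℚ) := by
    rw [Finset.sum_mul, Finset.sum_mul]
    refine hS₂q.trans (add_le_add (hre.le.trans ?_) (le_refl _))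
    rw [Finset.sum_add_distrib]
    apply add_le_add
    · refine (Finset.sum_le_sum_of_subset_of_nonneg hrange (fun j _ _ => by positivity)).trans' ?_
      apply le_of_eq
      apply Finset.sum_congr rfl
      intro j _
      ring
    · refine (Finset.sum_le_sum_of_subset_of_nonneg hrange (fun j _ _ => by positivity)).trans' ?_
      apply le_of_eq
      apply Finset.sum_congr rfl
      intro j _
      ring
  have hSq : (S.ncard : ℚ) ≤ (S₁.ncard : ℚ) + (S₂.ncard : ℚ) := by
    have : S.ncard ≤ S₁.ncard + S₂.ncard :=
      (ncard_le_ncard hsplit (hS₁fin.union hS₂fin)).trans (ncard_union_le _ _)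
    exact_mod_cast this
  rw [hS₁] at hSq
  linarith

end Matroid

end PercRepro
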